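import Mathlib
import Summits.AnomalousDissipation.AnomalousDissipation.Theorems.ConeDesingularisation.Negative.FedConeFlux

/-!
# Flux transfer VII: a point-flux cone — in particular a fed cone — charges the fundamental shell

Part of the flux-transfer package for the crux `ConeDesingularisation ↔ CascadeSoliton`
(stmt-AnomalousDissipation-19034/19036, route `PointSink`); headline and overview in
`…/ConeDesingularisation/Negative/FedConeFlux.lean`.

* `pointFluxCone_shell_charge`: for ANY measurable pair `(V, Π)` with `‖V‖³, |Π|^{3/2} ∈ L¹_loc(ℝ³∖0)`
  whose sharp log-mean energy flux through the fundamental shell `{1 < ‖x‖ < λ}` equals `−ε log λ` (the law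
  of `PointFluxCone`, resp. of a fed cone with `ε = D`), Young's inequality `(3, 3/2)` gives the floor
  `ε log λ ≤ (5/6) ∫_{1<‖x‖<λ} ‖V‖³ + (2/3) ∫_{1<‖x‖<λ} |Π|^{3/2}`:
  a point-flux cone of strength `ε` cannot be small in `L³ × L^{3/2}` on any fundamental shell — a profile
  constraint for cone hunters (convex-integration witnesses of `PointFluxCone` with `ε > 0` must carry this
  much `L³`/`L^{3/2}` mass per shell), complementing the `L²` shell-mass floor of `FarFieldMass`.
* `fedCone_shell_charge`: for the `L³ × L^{3/2}` far field `(V, Π)` of a cascade soliton with dissipation `D`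
  (`fedCone_logMeanFlux_eq`): `D log λ ≤ (5/6) ‖V‖³_{L³(shell)} + (2/3) ‖Π‖^{3/2}_{L^{3/2}(shell)}`. [folklore]
-/

-- `Summit.<Summit>.<Problem>` is the tree's mandated summit-side namespace (CONVENTIONS §2).
set_option linter.dupNamespace false

noncomputable section

namespace Summit.AnomalousDissipation.AnomalousDissipation.Theorems.ConeDesingularisation.Negative

open MeasureTheory Filter Topology Set Metric
open scoped InnerProductSpace ContDiff
open Literature.Analysis.FunctionSpaces Literature.Analysis.FluidPDE

/-- **A point-flux cone charges the fundamental shell.** If `(V, Π)` is measurable with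
`‖V‖³, |Π|^{3/2} ∈ L¹_loc(ℝ³∖0)` and its sharp log-mean flux through `{1 < ‖x‖ < λ}` is `−ε log λ`, then
`ε log λ ≤ (5/6) ∫_{1<‖x‖<λ} ‖V‖³ + (2/3) ∫_{1<‖x‖<λ} |Π|^{3/2}` (`|⟪V, x⟫|/‖x‖² ≤ ‖V‖` on `‖x‖ > 1`,
`|½‖V‖² + Π| ‖V‖ ≤ ½‖V‖³ + |Π| ‖V‖`, Young `(3, 3/2)`). [folklore] -/
theorem pointFluxCone_shell_charge {V : EuclideanSpace ℝ (Fin 3) → EuclideanSpace ℝ (Fin 3)}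
    {Pc : EuclideanSpace ℝ (Fin 3) → ℝ}
    (hVm : AEStronglyMeasurable V volume) (hPcm : AEStronglyMeasurable Pc volume)
    (hV3 : LocallyIntegrableOn (fun x => ‖V x‖ ^ 3) {x : EuclideanSpace ℝ (Fin 3) | x ≠ 0} volume)
    (hPc32 : LocallyIntegrableOn (fun x => |Pc x| ^ (3 / 2 : ℝ)) {x : EuclideanSpace ℝ (Fin 3) | x ≠ 0} volume)
    {lam : ℝ} {ε : ℝ}
    (hflux : ∫ x in {x : EuclideanSpace ℝ (Fin 3) | 1 < ‖x‖ ∧ ‖x‖ < lam},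
      (‖V x‖ ^ 2 / 2 + Pc x) * (⟪V x, x⟫_ℝ / ‖x‖ ^ 2) = -(ε * Real.log lam)) :
    ε * Real.log lam ≤ 5 / 6 * (∫ x in {x : EuclideanSpace ℝ (Fin 3) | 1 < ‖x‖ ∧ ‖x‖ < lam}, ‖V x‖ ^ 3) +
      2 / 3 * ∫ x in {x : EuclideanSpace ℝ (Fin 3) | 1 < ‖x‖ ∧ ‖x‖ < lam}, |Pc x| ^ (3 / 2 : ℝ) := by
  set S : Set (EuclideanSpace ℝ (Fin 3)) := {x : EuclideanSpace ℝ (Fin 3) | 1 < ‖x‖ ∧ ‖x‖ < lam} with hS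
  have hSm : MeasurableSet S := measurableSet_shell 1 lam
  have hV3S : IntegrableOn (fun x => ‖V x‖ ^ 3) S volume :=
    integrableOn_shell_of_locallyIntegrableOn hV3 one_pos lam
  have hP32S : IntegrableOn (fun x => |Pc x| ^ (3 / 2 : ℝ)) S volume :=
    integrableOn_shell_of_locallyIntegrableOn hPc32 one_pos lam
  have hF : IntegrableOn (fun x => (‖V x‖ ^ 2 / 2 + Pc x) * (⟪V x, x⟫_ℝ / ‖x‖ ^ 2)) S volume :=
    integrableOn_fluxDensity_shell hVm hPcm hV3 hPc32 lam
  have hpt : ∀ x ∈ S, -((‖V x‖ ^ 2 / 2 + Pc x) * (⟪V x, x⟫_ℝ / ‖x‖ ^ 2)) ≤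
      5 / 6 * ‖V x‖ ^ 3 + 2 / 3 * |Pc x| ^ (3 / 2 : ℝ) := by
    intro x hx
    have hx1 : 1 < ‖x‖ := hx.1
    have h1 : |⟪V x, x⟫_ℝ / ‖x‖ ^ 2| ≤ ‖V x‖ := by
      rw [abs_div, abs_of_pos (by positivity : (0 : ℝ) < ‖x‖ ^ 2), div_le_iff₀ (by positivity)]
      calc |⟪V x, x⟫_ℝ| ≤ ‖V x‖ * ‖x‖ := abs_real_inner_le_norm _ _
        _ ≤ ‖V x‖ * ‖x‖ ^ 2 := mul_le_mul_of_nonneg_left (by nlinarith) (norm_nonneg _)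
    have h2 : |‖V x‖ ^ 2 / 2 + Pc x| ≤ ‖V x‖ ^ 2 / 2 + |Pc x| := by
      calc |‖V x‖ ^ 2 / 2 + Pc x| ≤ |‖V x‖ ^ 2 / 2| + |Pc x| := abs_add_le _ _
        _ = ‖V x‖ ^ 2 / 2 + |Pc x| := by rw [abs_of_nonneg (by positivity)]
    have hy := young_three_threeHalves (norm_nonneg (V x)) (abs_nonneg (Pc x))
    calc -((‖V x‖ ^ 2 / 2 + Pc x) * (⟪V x, x⟫_ℝ / ‖x‖ ^ 2))
        ≤ |(‖V x‖ ^ 2 / 2 + Pc x) * (⟪V x, x⟫_ℝ / ‖x‖ ^ 2)| := neg_le_abs _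
      _ = |‖V x‖ ^ 2 / 2 + Pc x| * |⟪V x, x⟫_ℝ / ‖x‖ ^ 2| := abs_mul _ _
      _ ≤ (‖V x‖ ^ 2 / 2 + |Pc x|) * ‖V x‖ := mul_le_mul h2 h1 (abs_nonneg _) (by positivity)
      _ = ‖V x‖ ^ 3 / 2 + ‖V x‖ * |Pc x| := by ring
      _ ≤ ‖V x‖ ^ 3 / 2 + (‖V x‖ ^ 3 / 3 + |Pc x| ^ (3 / 2 : ℝ) / (3 / 2)) := by linarith [hy]
      _ = 5 / 6 * ‖V x‖ ^ 3 + 2 / 3 * |Pc x| ^ (3 / 2 : ℝ) := by ring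
  have hmono : ∫ x in S, -((‖V x‖ ^ 2 / 2 + Pc x) * (⟪V x, x⟫_ℝ / ‖x‖ ^ 2)) ≤
      ∫ x in S, (5 / 6 * ‖V x‖ ^ 3 + 2 / 3 * |Pc x| ^ (3 / 2 : ℝ)) :=
    setIntegral_mono_on hF.neg ((hV3S.const_mul _).add (hP32S.const_mul _)) hSm hpt
  rw [integral_neg, hflux, neg_neg, integral_add (hV3S.const_mul _) (hP32S.const_mul _),
    integral_const_mul, integral_const_mul] at hmono
  exact hmono

/-- **A fed cone charges the fundamental shell.** For the `L³ × L^{3/2}` far field `(V, Π)` of a cascade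
soliton with dissipation `D = ∫ |∇Q|²` (hypotheses of `fedCone_logMeanFlux_eq`):
`D log λ ≤ (5/6) ∫_{1<‖x‖<λ} ‖V‖³ + (2/3) ∫_{1<‖x‖<λ} |Π|^{3/2}` — the cone cannot be `L³ × L^{3/2}`-small on
any fundamental shell, uniformly in the soliton through `D` alone. [folklore] -/
theorem fedCone_shell_charge {Q : EuclideanSpace ℝ (Fin 3) → EuclideanSpace ℝ (Fin 3)}
    {P : EuclideanSpace ℝ (Fin 3) → ℝ}
    (hNS : IsClassicalNSSolutionOn Set.univ 1 (fun _ _ => 0) (fun _ => Q) (fun _ => P))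
    (hmass : ∃ C : ℝ, ∀ R : ℝ, 1 ≤ R →
      ∫ x in ball (0 : EuclideanSpace ℝ (Fin 3)) R, ‖Q x‖ ^ 2 ≤ C * R ^ (5 / 3 : ℝ))
    (hDint : Integrable (fun x => frobeniusNormSq (fderiv ℝ Q x)))
    {lam : ℝ} {V : EuclideanSpace ℝ (Fin 3) → EuclideanSpace ℝ (Fin 3)} {Pc : EuclideanSpace ℝ (Fin 3) → ℝ}
    (hlam : 1 < lam) (hVm : AEStronglyMeasurable V volume) (hPcm : AEStronglyMeasurable Pc volume)
    (hV : ∀ x : EuclideanSpace ℝ (Fin 3), x ≠ 0 → V (lam • x) = lam ^ (-(2 / 3 : ℝ)) • V x)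
    (hPc : ∀ x : EuclideanSpace ℝ (Fin 3), x ≠ 0 → Pc (lam • x) = lam ^ (-(4 / 3 : ℝ)) * Pc x)
    (hV3 : LocallyIntegrableOn (fun x => ‖V x‖ ^ 3) {x : EuclideanSpace ℝ (Fin 3) | x ≠ 0} volume)
    (hPc32 : LocallyIntegrableOn (fun x => |Pc x| ^ (3 / 2 : ℝ)) {x : EuclideanSpace ℝ (Fin 3) | x ≠ 0} volume)
    (hL3 : Tendsto (fun k : ℕ => (lam ^ k)⁻¹ *
      ∫ x in {x : EuclideanSpace ℝ (Fin 3) | lam ^ k < ‖x‖ ∧ ‖x‖ < lam ^ (k + 1)}, ‖Q x - V x‖ ^ 3)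
      atTop (𝓝 0))
    (hP32 : Tendsto (fun k : ℕ => (lam ^ k)⁻¹ *
      ∫ x in {x : EuclideanSpace ℝ (Fin 3) | lam ^ k < ‖x‖ ∧ ‖x‖ < lam ^ (k + 1)}, |P x - Pc x| ^ (3 / 2 : ℝ))
      atTop (𝓝 0)) :
    (∫ x, frobeniusNormSq (fderiv ℝ Q x)) * Real.log lam ≤
      5 / 6 * (∫ x in {x : EuclideanSpace ℝ (Fin 3) | 1 < ‖x‖ ∧ ‖x‖ < lam}, ‖V x‖ ^ 3) +
        2 / 3 * ∫ x in {x : EuclideanSpace ℝ (Fin 3) | 1 < ‖x‖ ∧ ‖x‖ < lam}, |Pc x| ^ (3 / 2 : ℝ) :=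
  pointFluxCone_shell_charge hVm hPcm hV3 hPc32
    (fedCone_logMeanFlux_eq hNS hmass hDint hlam hVm hPcm hV hPc hV3 hPc32 hL3 hP32)

/-- In particular the far field of a cascade soliton is `L³ × L^{3/2}`-LARGE on the fundamental shell:
`(5/6) ∫ ‖V‖³ + (2/3) ∫ |Π|^{3/2} > 0` there, quantitatively `≥ D log λ > 0`. [folklore] -/
theorem fedCone_shell_charge_pos {Q : EuclideanSpace ℝ (Fin 3) → EuclideanSpace ℝ (Fin 3)}
    {P : EuclideanSpace ℝ (Fin 3) → ℝ}
    (hNS : IsClassicalNSSolutionOn Set.univ 1 (fun _ _ => 0) (fun _ => Q) (fun _ => P))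
    (hmass : ∃ C : ℝ, ∀ R : ℝ, 1 ≤ R →
      ∫ x in ball (0 : EuclideanSpace ℝ (Fin 3)) R, ‖Q x‖ ^ 2 ≤ C * R ^ (5 / 3 : ℝ))
    (hDint : Integrable (fun x => frobeniusNormSq (fderiv ℝ Q x)))
    (hDpos : 0 < ∫ x, frobeniusNormSq (fderiv ℝ Q x))
    {lam : ℝ} {V : EuclideanSpace ℝ (Fin 3) → EuclideanSpace ℝ (Fin 3)} {Pc : EuclideanSpace ℝ (Fin 3) → ℝ}
    (hlam : 1 < lam) (hVm : AEStronglyMeasurable V volume) (hPcm : AEStronglyMeasurable Pc volume)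
    (hV : ∀ x : EuclideanSpace ℝ (Fin 3), x ≠ 0 → V (lam • x) = lam ^ (-(2 / 3 : ℝ)) • V x)
    (hPc : ∀ x : EuclideanSpace ℝ (Fin 3), x ≠ 0 → Pc (lam • x) = lam ^ (-(4 / 3 : ℝ)) * Pc x)
    (hV3 : LocallyIntegrableOn (fun x => ‖V x‖ ^ 3) {x : EuclideanSpace ℝ (Fin 3) | x ≠ 0} volume)
    (hPc32 : LocallyIntegrableOn (fun x => |Pc x| ^ (3 / 2 : ℝ)) {x : EuclideanSpace ℝ (Fin 3) | x ≠ 0} volume)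
    (hL3 : Tendsto (fun k : ℕ => (lam ^ k)⁻¹ *
      ∫ x in {x : EuclideanSpace ℝ (Fin 3) | lam ^ k < ‖x‖ ∧ ‖x‖ < lam ^ (k + 1)}, ‖Q x - V x‖ ^ 3)
      atTop (𝓝 0))
    (hP32 : Tendsto (fun k : ℕ => (lam ^ k)⁻¹ *
      ∫ x in {x : EuclideanSpace ℝ (Fin 3) | lam ^ k < ‖x‖ ∧ ‖x‖ < lam ^ (k + 1)}, |P x - Pc x| ^ (3 / 2 : ℝ))
      atTop (𝓝 0)) :
    0 < 5 / 6 * (∫ x in {x : EuclideanSpace ℝ (Fin 3) | 1 < ‖x‖ ∧ ‖x‖ < lam}, ‖V x‖ ^ 3) +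
      2 / 3 * ∫ x in {x : EuclideanSpace ℝ (Fin 3) | 1 < ‖x‖ ∧ ‖x‖ < lam}, |Pc x| ^ (3 / 2 : ℝ) :=
  (mul_pos hDpos (Real.log_pos hlam)).trans_le
    (fedCone_shell_charge hNS hmass hDint hlam hVm hPcm hV hPc hV3 hPc32 hL3 hP32)

end Summit.AnomalousDissipation.AnomalousDissipation.Theorems.ConeDesingularisation.Negative
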